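import Literature.Probability.LatticeModels.LatticeGraph
import Literature.Probability.Percolation.Percolation
import Literature.Probability.Percolation.CriticalContinuity
import HarnessLib

/-!
# The anchored isoperimetric profile of the open cluster of the origin in bond percolation on `ℤ^d`

Topic `Literature/Probability/Percolation`. Named facts (no proofs) from

* [CerfDembin2020] R. Cerf, B. Dembin, *Vanishing of the anchored isoperimetric profile in bond
  percolation at `p_c`*, Electron. Commun. Probab. 25 (2020), arXiv:1903.08065 — Theorem 1.1
  (quoted there from [Dembin2020]) and Theorem 1.2;
* [Dembin2020] B. Dembin, *Existence of the anchored isoperimetric profile in supercritical bond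
  percolation in dimension two and higher*, ALEA 17 (2020) — the original source of Theorem 1.1.

They ground the isoperimetric leg of route `CriticalPhenomena/PercolationContinuityZ3/PercThresholdOne`
(items `SamePAnchoredIsoperimetry`, `StationaryWeavingVanishingProfile`, `IsoperimetricClosing`).

## The objects (CerfDembin2020, §1)

For a bond configuration `ω` on `ℤ^d` and a finite `H ⊂ ℤ^d`, the edge boundary of `H` *in the
open cluster* is `∂_{C(0)} H = {e = ⟨x, y⟩ open : x ∈ H, y ∉ H}` — the OPEN nearest-neighbour
edges with exactly one endpoint in `H` (printed: "`∂_𝒢 A = {e = ⟨x,y⟩ ∈ E : x ∈ A, y ∉ A}`" for the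
graph `𝒢 = C(0)` with its open edges); in the tree this is
`↑(LatticeModels.edgeBoundary (zdGraph d) H) ∩ ω`. `H` is a *valid subgraph of `C(0)`* if
"`H` is connected and `0 ∈ H ⊂ C(0)`", read (as a subgraph of the open graph `C(0)`) as: every
`x ∈ H` is joined to `0` by an open path inside `H` — the tree's `ω ∈ openConnIn ↑H 0 x`; this
forces `0 ∈ H ⊆ C(0)`. The anchored isoperimetric profile at level `n` is
`φ̂_n(p)(ω) = min { |∂_{C(0)} H| / |H| : H valid, 0 < |H| ≤ n^d }` (`anchoredProfile`; for
`p > p_c` and on `{0 ∈ C_∞}` it is the profile `φ_n(p)` of `C_∞ = C(0)` of [Dembin2020]).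

## The facts

* `CerfDembin2020_thm11` — **existence and positivity for `p > p_c`** [CerfDembin2020, Thm 1.1;
  Dembin2020]: for `d ≥ 2`, `p > p_c(d)` there is `φ(p) > 0` with `n φ̂_n(p) → φ(p)` a.s. on
  `{0 ∈ C_∞}`.
* `CerfDembin2020_thm12` — **vanishing at `p_c`** [CerfDembin2020, Thm 1.2]: for `d ≥ 2`,
  `P_{p_c}`-a.s. `liminf_n n φ̂_n(p_c) = 0`. We state it in the `ε`–`N` form
  "`∀ c > 0 ∀ N ∃ n ≥ N ∃ valid H, |H| ≤ n^d ∧ n |∂_{C(0)}H| ≤ c |H|`", which is equivalent to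
  `liminf = 0` because `φ̂_n ≥ 0` and the minimum is attained, and which avoids the junk value of
  `Filter.liminf` in `ℝ` for sequences unbounded above. (If `C(0)` is finite the statement is
  trivial with `H = C(0)`, whose open edge boundary is empty — as remarked in the paper.)

## Design / junk values

`anchoredProfile d n ω` is an `sInf` over a finite set of ratios (finitely many `H ∋ 0` connected
to `0` with `|H| ≤ n^d`); for `n = 0` the set is empty and the value is the junk `sInf ∅ = 0`
(irrelevant: both facts are asymptotic in `n`). No new notion beyond the tree's `bondPercolation`,
`openConnIn`, `openCluster`, `criticalProbI`, `criticalProb`, `edgeBoundary`, `zdGraph`.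
-/

noncomputable section

namespace Literature.Probability.Percolation

open MeasureTheory Filter LatticeModels
open scoped Topology

variable (d : ℕ)

/-- A *valid subgraph of the open cluster of the origin* [CerfDembin2020, §1]: a finite vertex set
`H ∋ 0` every point of which is joined to `0` by an open path inside `H` (so `H ⊆ C(0)` and `H` is
connected through open edges). [cite: CerfDembin2020, §1 (valid subgraph of C(0))] -/
def IsValidSubgraph (ω : BondConfig (Site d)) (H : Finset (Site d)) : Prop :=
  (0 : Site d) ∈ H ∧ ∀ x ∈ H, ω ∈ openConnIn (↑H : Set (Site d)) 0 x

/-- The number `|∂_{C(0)} H|` of OPEN nearest-neighbour edges of `ℤ^d` with exactly one endpoint in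
`H` (the edge boundary of `H` in the graph `C(0)`). [cite: CerfDembin2020, §1 (∂_𝒢 A)] -/
def openEdgeBoundaryCard (ω : BondConfig (Site d)) (H : Finset (Site d)) : ℕ :=
  ((↑(edgeBoundary (zdGraph d) H) : Set (Sym2 (Site d))) ∩ ω).ncard

/-- The anchored isoperimetric profile of `C(0)` at level `n`,
`φ̂_n(ω) = min { |∂_{C(0)} H| / |H| : H valid subgraph of C(0), 0 < |H| ≤ n^d }`
[CerfDembin2020, §1, display defining `φ̂_n(p)`]; an `sInf` over a finite set of ratios (junk `0`
when `n = 0` and the set is empty). [cite: CerfDembin2020, §1 (definition of φ̂_n)] -/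
def anchoredProfile (n : ℕ) (ω : BondConfig (Site d)) : ℝ :=
  sInf {r : ℝ | ∃ H : Finset (Site d), IsValidSubgraph d ω H ∧ 0 < H.card ∧ H.card ≤ n ^ d ∧
    r = (openEdgeBoundaryCard d ω H : ℝ) / H.card}

/-- **Cerf–Dembin 2020, Theorem 1.1 (= Dembin 2020): existence and positivity of the anchored
isoperimetric profile in the supercritical regime.** "Let `d ≥ 2` and `p > p_c(d)`. There exists a
positive real number `φ(p)` such that, conditionally on `{0 ∈ C_∞}`, `lim_{n→∞} n φ_n(p) = φ(p)`
almost surely." On `{0 ∈ C_∞} = {C(0) infinite}` the profile `φ_n(p)` of `C_∞` is `φ̂_n(p)`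
(`anchoredProfile`). Proved by coarse graining at `p > p_c` (not available at `p_c`).
[cite: CerfDembin2020, Thm 1.1] -/
def CerfDembin2020_thm11 : Prop :=
  ∀ d : ℕ, 2 ≤ d → ∀ p : unitInterval, criticalProb (zdGraph d) (0 : Site d) < (p : ℝ) →
    ∃ φ : ℝ, 0 < φ ∧ ∀ᵐ ω ∂(bondPercolation (zdGraph d) p), (openCluster ω 0).Infinite →
      Tendsto (fun n : ℕ => (n : ℝ) * anchoredProfile d n ω) atTop (𝓝 φ)

/-- **Cerf–Dembin 2020, Theorem 1.2: the anchored isoperimetric profile vanishes at `p_c` along a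
subsequence.** "With probability one, we have `liminf_{n→∞} n φ̂_n(p_c) = 0`" (bond percolation on
`ℤ^d`, `d ≥ 2`, at `p = p_c(d)`; proof: exploration of `C(0)` inside `[-n,n]^d` + absence of
percolation in half-spaces at `p_c`). Stated in the equivalent `ε`–`N` form: for every `c > 0` and
`N` there are `n ≥ N` and a valid `H` with `|H| ≤ n^d` and `n |∂_{C(0)} H| ≤ c |H|` (equivalent to
`liminf = 0` since `φ̂_n ≥ 0` and the minimum over the finite set is attained; trivial when `C(0)` is
finite, with `H = C(0)`). Grounds `Summit.CriticalPhenomena.PercolationContinuityZ3.Theses.PercThresholdOne.StationaryWeavingVanishingProfile`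
(the route item is the generalisation from `P_{p_c}` to stationary weaving laws, `d = 3`).
[cite: CerfDembin2020, Thm 1.2] -/
def CerfDembin2020_thm12 : Prop :=
  ∀ d : ℕ, 2 ≤ d →
    ∀ᵐ ω ∂(bondPercolation (zdGraph d) (criticalProbI d)),
      ∀ c : ℝ, 0 < c → ∀ N : ℕ, ∃ n : ℕ, N ≤ n ∧ ∃ H : Finset (Site d),
        IsValidSubgraph d ω H ∧ H.card ≤ n ^ d ∧
        (n : ℝ) * (openEdgeBoundaryCard d ω H : ℝ) ≤ c * H.card

end Literature.Probability.Percolation
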